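import Summits.QuantumFields.QCD.Theorems.WindowExtinction.Negative.SpectralFlowLocal
import Summits.QuantumFields.QCD.Theorems.ExtinctionBuildsQCD.Negative.InertiaPencil
import Summits.QuantumFields.QCD.Theorems.ExtinctionBuildsQCD.Negative.ChiralInertia

/-!
# Haynsworth inertia additivity (sub-goal `negRootCount_fromBlocks_haynsworth` of crux stmt-QuantumFields-8967)

Deterministic linear algebra for the modular cell–wall template (crux idea `Cruxes/TipPricing/Ideas/modular-cell-wall-template.md`,
lead c2; serves stub `stub_spreadOfCells` of line `hermitian-flow-coarea` r3 for crux `TipPricing`, and equally 8964-r3's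
`stub_inertiaMonotone`): for a Hermitian block matrix `[[A, B],[Bᴴ, D]]` with invertible Hermitian pivot `D`,
`n₋([[A,B],[Bᴴ,D]]) = n₋(D) + n₋(A − B D⁻¹ Bᴴ)` (Haynsworth 1968), via the LDU congruence
(Mathlib `Matrix.fromBlocks_eq_of_invertible₂₂`), Sylvester's law of inertia in counting form (congruence invariance of the
negative root count, from the tree's `card_le_card_eigenvalues_of_form_pos`), and additivity over a block-diagonal
(`Matrix.charpoly_fromBlocks_zero₁₂`).  Supports stmt-QuantumFields-8967 (helper; closes no item).
-/

namespace Summit.QuantumFields.QCD.Cruxes.TipPricing.ModularTemplate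

open Matrix Polynomial
open Summit.QuantumFields.QCD.Theorems.ExtinctionBuildsQCD.Negative
open Summit.QuantumFields.QCD.Theorems.WindowExtinction.Negative
open scoped BigOperators

/-- Congruence bookkeeping for the Hermitian form: if `P Q = 1`, then on the pulled-back vector `Q y` the form of
`Pᴴ N P` is the form of `N` on `y`, `(Q y)† (Pᴴ N P) (Q y) = y† N y`. [folklore] -/
theorem haynsworth_form_congr {k : Type*} [Fintype k] [DecidableEq k] {N P Q : Matrix k k ℂ}
    (hPQ : P * Q = 1) (y : k → ℂ) :
    star (Q *ᵥ y) ⬝ᵥ ((Pᴴ * N * P) *ᵥ (Q *ᵥ y)) = star y ⬝ᵥ (N *ᵥ y) := by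
  rw [mulVec_mulVec, Matrix.mul_assoc (Pᴴ * N) P Q, hPQ, Matrix.mul_one, ← mulVec_mulVec,
    dotProduct_mulVec, ← star_mulVec, mulVec_mulVec, hPQ, one_mulVec]

/-- **Sylvester's law of inertia, one direction, in counting form**: for a Hermitian `N` and a `P` with a right
inverse `Q`, `n₋(N) ≤ n₋(Pᴴ N P)` — the negative eigenspace of `N` (spanned through the eigenvector unitary), pulled
back through `Q`, is a subspace of dimension `n₋(N)` on which the form of `Pᴴ N P` is negative; apply the tree's
inertia bound `card_le_card_eigenvalues_of_form_pos`. [folklore] -/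
theorem haynsworth_negRootCount_le {k : Type*} [Fintype k] [DecidableEq k] {N P Q : Matrix k k ℂ}
    (hN : N.IsHermitian) (hPQ : P * Q = 1) :
    negRootCount N ≤ negRootCount (Pᴴ * N * P) := by
  have hM : (Pᴴ * N * P).IsHermitian := isHermitian_conjTranspose_mul_mul P hN
  set U : Matrix k k ℂ := (hN.eigenvectorUnitary : Matrix k k ℂ) with hU
  have hUmem : U ∈ Matrix.unitaryGroup k ℂ := (hN.eigenvectorUnitary).2
  rw [negRootCount_eq_card hN, negRootCount_eq_card hM, ← Fintype.card_subtype]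
  have h := card_le_card_eigenvalues_of_form_pos hM (-1)
    ((Matrix.mulVecLin Q) ∘ₗ (Matrix.mulVecLin U) ∘ₗ extendByZero (fun i => hN.eigenvalues i < 0))
    (fun c hc => ?_)
  · simpa only [neg_mul, one_mul, Left.neg_pos_iff] using h
  · simp only [LinearMap.coe_comp, Function.comp_apply, Matrix.mulVecLin_apply, neg_mul, one_mul,
      Left.neg_pos_iff]
    rw [haynsworth_form_congr hPQ, re_form_eq_sum_eigenvalues hN, ← hU,
      conjTranspose_mulVec_mulVec_of_mem_unitaryGroup hUmem]
    set x := extendByZero (fun i => hN.eigenvalues i < 0) c with hx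
    have hle : ∀ i ∈ Finset.univ, hN.eigenvalues i * ‖x i‖ ^ 2 ≤ 0 := by
      intro i _
      by_cases hi : hN.eigenvalues i < 0
      · exact mul_nonpos_of_nonpos_of_nonneg hi.le (by positivity)
      · rw [hx, extendByZero_apply_of_neg c hi, norm_zero]
        simp
    obtain ⟨j, hj⟩ : ∃ j, x j ≠ 0 := Function.ne_iff.mp (extendByZero_ne_zero hc)
    have hjneg : hN.eigenvalues j < 0 := by
      by_contra hcon
      exact hj (by rw [hx]; exact extendByZero_apply_of_neg c hcon)
    have hlt : hN.eigenvalues j * ‖x j‖ ^ 2 < 0 :=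
      mul_neg_of_neg_of_pos hjneg (pow_pos (norm_pos_iff.mpr hj) 2)
    have hsum := Finset.sum_lt_sum hle ⟨j, Finset.mem_univ _, hlt⟩
    simpa using hsum

/-- **Sylvester's law of inertia in counting form**: congruence by an invertible matrix preserves the number of
negative eigenvalues of a Hermitian matrix, `n₋(Pᴴ N P) = n₋(N)` (`P Q = 1`; the reverse inequality is the forward
one for `Qᴴ (Pᴴ N P) Q = N`). [folklore] -/
theorem haynsworth_negRootCount_congr {k : Type*} [Fintype k] [DecidableEq k] {N P Q : Matrix k k ℂ}
    (hN : N.IsHermitian) (hPQ : P * Q = 1) :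
    negRootCount (Pᴴ * N * P) = negRootCount N := by
  refine le_antisymm ?_ (haynsworth_negRootCount_le hN hPQ)
  have hQP : Q * P = 1 := mul_eq_one_comm.mp hPQ
  have hM : (Pᴴ * N * P).IsHermitian := isHermitian_conjTranspose_mul_mul P hN
  have h := haynsworth_negRootCount_le hM hQP
  have hback : Qᴴ * (Pᴴ * N * P) * Q = N := by
    calc Qᴴ * (Pᴴ * N * P) * Q = (P * Q)ᴴ * N * (P * Q) := by
          rw [conjTranspose_mul]
          simp only [Matrix.mul_assoc]
      _ = N := by rw [hPQ, conjTranspose_one, Matrix.one_mul, Matrix.mul_one]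
  rwa [hback] at h

/-- Negative root counts add over a two-block block-diagonal matrix (`charpoly (S ⊕ D) = charpoly S · charpoly D`,
Mathlib `Matrix.charpoly_fromBlocks_zero₁₂`). [folklore] -/
theorem haynsworth_negRootCount_fromBlocks_zero {m n : Type*} [Fintype m] [Fintype n] [DecidableEq m]
    [DecidableEq n] (S : Matrix m m ℂ) (D : Matrix n n ℂ) :
    negRootCount (fromBlocks S 0 0 D) = negRootCount S + negRootCount D := by
  unfold negRootCount
  rw [Matrix.charpoly_fromBlocks_zero₁₂,
    Polynomial.roots_mul (mul_ne_zero (Matrix.charpoly_monic S).ne_zero (Matrix.charpoly_monic D).ne_zero),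
    Multiset.countP_add]

/-- **Haynsworth inertia additivity** for a Hermitian block matrix with invertible Hermitian pivot `D`:
`n₋([[A, B],[Bᴴ, D]]) = n₋(D) + n₋(A − B D⁻¹ Bᴴ)`. [folklore] -/
theorem negRootCount_fromBlocks_haynsworth {m n : Type*} [Fintype m] [Fintype n] [DecidableEq m] [DecidableEq n]
    (A : Matrix m m ℂ) (B : Matrix m n ℂ) (D : Matrix n n ℂ) (hA : A.IsHermitian) (hD : D.IsHermitian) (hDdet : D.det ≠ 0) :
    negRootCount (Matrix.fromBlocks A B Bᴴ D) = negRootCount D + negRootCount (A - B * D⁻¹ * Bᴴ) := by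
  have hDu : IsUnit D.det := isUnit_iff_ne_zero.mpr hDdet
  have hDD : D * D⁻¹ = 1 := D.mul_nonsing_inv hDu
  have hDD' : D⁻¹ * D = 1 := D.nonsing_inv_mul hDu
  have hDinv : D⁻¹ᴴ = D⁻¹ := by rw [conjTranspose_nonsing_inv, hD.eq]
  set S : Matrix m m ℂ := A - B * D⁻¹ * Bᴴ with hS
  set L : Matrix n m ℂ := D⁻¹ * Bᴴ with hL
  set P : Matrix (m ⊕ n) (m ⊕ n) ℂ := fromBlocks 1 0 L 1 with hP
  set Q : Matrix (m ⊕ n) (m ⊕ n) ℂ := fromBlocks 1 0 (-L) 1 with hQ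
  set N : Matrix (m ⊕ n) (m ⊕ n) ℂ := fromBlocks S 0 0 D with hN
  -- `P` is block unitriangular, with the explicit inverse `Q`
  have hPQ : P * Q = 1 := by
    rw [hP, hQ, fromBlocks_multiply]
    simp
  -- the LDU congruence `H = Pᴴ N P`
  have hLH : Lᴴ = B * D⁻¹ := by
    rw [hL, conjTranspose_mul, conjTranspose_conjTranspose, hDinv]
  have h1 : Lᴴ * D = B := by rw [hLH, Matrix.mul_assoc, hDD', Matrix.mul_one]
  have h2 : D * L = Bᴴ := by rw [hL, ← Matrix.mul_assoc, hDD, Matrix.one_mul]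
  have h3 : S + B * L = A := by rw [hS, hL, ← Matrix.mul_assoc, sub_add_cancel]
  have hfact : fromBlocks A B Bᴴ D = Pᴴ * N * P := by
    rw [hP, hN, fromBlocks_conjTranspose, fromBlocks_multiply, fromBlocks_multiply]
    simp only [conjTranspose_one, conjTranspose_zero, Matrix.one_mul, Matrix.mul_one, Matrix.mul_zero,
      Matrix.zero_mul, add_zero, zero_add, h1, h2, h3]
  -- `N = S ⊕ D` is Hermitian
  have hSh : S.IsHermitian := hA.sub (isHermitian_mul_mul_conjTranspose B hD.inv)
  have hNh : N.IsHermitian := Matrix.IsHermitian.fromBlocks hSh (by simp) hD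
  -- Sylvester + block additivity
  rw [hfact, haynsworth_negRootCount_congr hNh hPQ, hN, haynsworth_negRootCount_fromBlocks_zero, add_comm]

end Summit.QuantumFields.QCD.Cruxes.TipPricing.ModularTemplate
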